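import Summits.ResolutionOfSingularities.ResolutionOfSingularities.Theorems.LossEntryW22
import HarnessLib

/-!
# LossEntryW23 (= lens-3 g29 slice 15) — walk plumbing of the loss→entry law — (S3′) frame independence without the layer hypothesis

decomp-res-lens-3, gen 29 (NODE-g29 §3ter).  TOOL at 0.  Imports `Theorems.LossEntryW22`.

§35 — FRAME INDEPENDENCE WITHOUT THE LAYER HYPOTHESIS (NODE-g29 §3ter (S3′)): `toLex_resPoint_le_of_partner′`, **`vertexOf_polyPts_eq_of_lineDom′`**,
**`vertexOf_polyPts_two_frames′`** / `betaOf_polyPts_two_frames′` — §32 with «no axis point in frame 1» replaced by the wall `r a ≤ E′ a` and the degree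
bound `r a + s ≤ |E′|` (on the axis both abscissae vanish and `E_b + E_c ≥ s` orders the ordinates), and the walk-level
**`betaOf_polyPts_two_frames_walk`**: at ANY one-wall walk state (`r_v = M e_a`, degrees `≥ M+s`, `q ≤ s+M`) and `νλ = 1`, the readings `(a;c,b)` after
`σ_{b,c,ν}` and `(a;b,c)` after `σ_{c,b,λ}` have the same `ŷ` and `x̂` — every hypothesis a walk fact.
-/

open MvPolynomial Finset
open Literature.AlgebraicGeometry.Resolution
open Literature.AlgebraicGeometry.Resolution.Hauser2010
open Literature.AlgebraicGeometry.Resolution.PointBlowup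
open Summit.ResolutionOfSingularities.ResolutionOfSingularities.Theorems.TightDefectClasses
open Summit.ResolutionOfSingularities.ResolutionOfSingularities.Theorems.TightDefectStrongWalks
open Summit.ResolutionOfSingularities.ResolutionOfSingularities.Theorems.ItineraryCutClasses
open Summit.ResolutionOfSingularities.ResolutionOfSingularities.Theorems.BoundaryLedger
open Summit.ResolutionOfSingularities.ResolutionOfSingularities.Theorems.ProximityCut
open Summit.ResolutionOfSingularities.ResolutionOfSingularities.Theorems.LossExitCone
open Summit.ResolutionOfSingularities.ResolutionOfSingularities.Theorems.LossPolygon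

/-! ## §35 FRAME INDEPENDENCE WITHOUT THE LAYER HYPOTHESIS (NODE-g29 §3ter (S3′)): the degree bound `r a + s ≤ |E|` replaces «no axis point» -/

namespace Summit.ResolutionOfSingularities.ResolutionOfSingularities.Theorems.LossPolygon

variable {K : Type} [Field K] {q : ℕ}

section FrameDomDegree

variable {a b c : Fin 3}

/-- Cross-frame partner comparison, axis allowed: as `toLex_resPoint_le_of_partner`, but with `r a ≤ D a` and the degree bound
`r a + s ≤ |D|` instead of `r a < D a` — on the axis both abscissae vanish and `D b + D c ≥ s` orders the ordinates. [new; elementary] -/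
theorem toLex_resPoint_le_of_partner' (hab : a ≠ b) (hac : a ≠ c) (hbc : b ≠ c) {s : ℕ} {r : Fin 3 →₀ ℕ}
    (hrb : r b = 0) (hrc : r c = 0) {D P : Fin 3 →₀ ℕ} (hPa : P a = D a) (hdeg : P.degree = D.degree) (hle : P c ≤ D b)
    (hDb : D b < s) (hwall : r a ≤ D a) (hdegD : r a + s ≤ D.degree) :
    toLex (resPoint s r a b c P) ≤ toLex (resPoint s r a c b D) := by
  have h1 := degree_fin3 hab hac hbc P
  have h2 := degree_fin3 hab hac hbc D
  have hPb : P b + P c = D b + D c := by omega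
  have hxP : (resPoint s r a b c P).1 = ((((D a : ℕ) : ℚ)) - r a) / (((s : ℕ) : ℚ) - P c) := by
    show ((((P a : ℕ) : ℚ)) - r a) / (((s : ℕ) : ℚ) + r c - P c) = _
    rw [hPa, hrc, Nat.cast_zero, add_zero]
  have hyP : (resPoint s r a b c P).2 = (((P b : ℕ) : ℚ)) / (((s : ℕ) : ℚ) - P c) := by
    show ((((P b : ℕ) : ℚ)) - r b) / (((s : ℕ) : ℚ) + r c - P c) = _
    rw [hrb, hrc, Nat.cast_zero, add_zero, sub_zero]
  have hxD : (resPoint s r a c b D).1 = ((((D a : ℕ) : ℚ)) - r a) / (((s : ℕ) : ℚ) - D b) := by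
    show ((((D a : ℕ) : ℚ)) - r a) / (((s : ℕ) : ℚ) + r b - D b) = _
    rw [hrb, Nat.cast_zero, add_zero]
  have hyD : (resPoint s r a c b D).2 = (((D c : ℕ) : ℚ)) / (((s : ℕ) : ℚ) - D b) := by
    show ((((D c : ℕ) : ℚ)) - r c) / (((s : ℕ) : ℚ) + r b - D b) = _
    rw [hrb, hrc, Nat.cast_zero, add_zero, sub_zero]
  have hd : (0 : ℚ) < ((s : ℕ) : ℚ) - D b := by
    have : ((D b : ℕ) : ℚ) < s := by exact_mod_cast hDb
    linarith
  have hcb : ((P c : ℕ) : ℚ) ≤ D b := by exact_mod_cast hle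
  have hd' : (0 : ℚ) < ((s : ℕ) : ℚ) - P c := by linarith
  rw [toLex_le_toLex_iff, hxP, hyP, hxD, hyD]
  rcases Nat.eq_or_lt_of_le hwall with hax | hpos
  · -- on the axis
    right
    refine ⟨by rw [hax, sub_self, zero_div, zero_div], ?_⟩
    have hs' : s ≤ D b + D c := by omega
    have hbs : ((s : ℕ) : ℚ) ≤ ((D b : ℕ) : ℚ) + D c := by exact_mod_cast hs'
    have hsum : ((P b : ℕ) : ℚ) + P c = ((D b : ℕ) : ℚ) + D c := by exact_mod_cast hPb
    have hPbq : ((P b : ℕ) : ℚ) = ((D b : ℕ) : ℚ) + D c - P c := by linarith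
    rw [div_le_div_iff₀ hd' hd, hPbq]
    nlinarith [mul_nonneg (sub_nonneg.mpr hcb) (by linarith : (0 : ℚ) ≤ ((D b : ℕ) : ℚ) + D c - s)]
  · rcases Nat.eq_or_lt_of_le hle with h | h
    · -- equal denominators: the two points coincide
      right
      have hPb' : P b = D c := by omega
      rw [h, hPb']
      exact ⟨rfl, le_rfl⟩
    · left
      have hN : (0 : ℚ) < (((D a : ℕ) : ℚ)) - r a := by
        have : ((r a : ℕ) : ℚ) < D a := by exact_mod_cast hpos
        linarith
      have hdd : ((s : ℕ) : ℚ) - D b < ((s : ℕ) : ℚ) - P c := by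
        have : ((P c : ℕ) : ℚ) < D b := by exact_mod_cast h
        linarith
      exact div_lt_div_of_pos_left hN hd hdd

/-- **FRAME INDEPENDENCE UNDER LINE DOMINATION, axis allowed (PROVED; NODE-g29 §3ter (S3′)).**  As `vertexOf_polyPts_eq_of_lineDom`, with the
hypothesis «no axis point in frame 1» replaced by the wall `r a ≤ E′ a` and the degree bound `r a + s ≤ |E′|` on `G₁` — both walk facts. [new] -/
theorem vertexOf_polyPts_eq_of_lineDom' (hab : a ≠ b) (hac : a ≠ c) (hbc : b ≠ c) {s : ℕ} {r : Fin 3 →₀ ℕ}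
    (hrb : r b = 0) (hrc : r c = 0) {G₁ G₂ : MvPolynomial (Fin 3) K}
    (h12 : ∀ E ∈ G₂.support, E b < s → ∃ E' ∈ G₁.support, E' a = E a ∧ E'.degree = E.degree ∧ E' c ≤ E b)
    (h21 : ∀ E' ∈ G₁.support, E' c < s → ∃ E ∈ G₂.support, E a = E' a ∧ E.degree = E'.degree ∧ E b ≤ E' c)
    (hwall : ∀ E' ∈ G₁.support, r a ≤ E' a) (hdeg : ∀ E' ∈ G₁.support, r a + s ≤ E'.degree)
    (hne : (polyPts s r a b c G₁).Nonempty) :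
    (polyPts s r a c b G₂).Nonempty ∧ vertexOf (polyPts s r a c b G₂) = vertexOf (polyPts s r a b c G₁) := by
  classical
  have hA : ∀ x ∈ polyPts s r a c b G₂, ∃ y ∈ polyPts s r a b c G₁, toLex y ≤ toLex x := by
    intro x hx
    obtain ⟨E, hE, rfl⟩ := Finset.mem_image.mp hx
    obtain ⟨hEG, hEb⟩ := Finset.mem_filter.mp hE
    have hEb' : E b < s := by rw [hrb, add_zero] at hEb; exact hEb
    obtain ⟨E', hE'G, hE'a, hE'deg, hE'c⟩ := h12 E hEG hEb'
    have hE'c' : E' c < s := lt_of_le_of_lt hE'c hEb'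
    refine ⟨resPoint s r a b c E', Finset.mem_image_of_mem _ (Finset.mem_filter.mpr ⟨hE'G, by rw [hrc, add_zero]; exact hE'c'⟩), ?_⟩
    exact toLex_resPoint_le_of_partner' hab hac hbc hrb hrc hE'a hE'deg hE'c hEb' (by rw [← hE'a]; exact hwall E' hE'G)
      (by rw [← hE'deg]; exact hdeg E' hE'G)
  have hB : ∀ y ∈ polyPts s r a b c G₁, ∃ x ∈ polyPts s r a c b G₂, toLex x ≤ toLex y := by
    intro y hy
    obtain ⟨E', hE', rfl⟩ := Finset.mem_image.mp hy
    obtain ⟨hE'G, hE'c⟩ := Finset.mem_filter.mp hE'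
    have hE'c' : E' c < s := by rw [hrc, add_zero] at hE'c; exact hE'c
    obtain ⟨E, hEG, hEa, hEdeg, hEb⟩ := h21 E' hE'G hE'c'
    have hEb' : E b < s := lt_of_le_of_lt hEb hE'c'
    refine ⟨resPoint s r a c b E, Finset.mem_image_of_mem _ (Finset.mem_filter.mpr ⟨hEG, by rw [hrb, add_zero]; exact hEb'⟩), ?_⟩
    exact toLex_resPoint_le_of_partner' hac hab hbc.symm hrc hrb hEa hEdeg hEb hE'c' (hwall E' hE'G) (hdeg E' hE'G)
  obtain ⟨y, hy⟩ := hne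
  obtain ⟨x, hx, -⟩ := hB y hy
  exact ⟨⟨x, hx⟩, vertexOf_eq_of_dom ⟨x, hx⟩ ⟨y, hy⟩ hA hB⟩

/-- **FRAME INDEPENDENCE OF THE STRAIGHTENED WALL POLYGON, axis allowed (PROVED; NODE-g29 §3ter (S3′)).**  For `ν·λ = 1` and ANY `F` with the
wall `r a ≤ D a` and all degrees `≥ r a + s` (walk facts `walk_r`, `hord`): the `σ_{b,c,ν}`-straightened re-cleaned equation read in frame
`(a ; c, b)` and the `σ_{c,b,λ}`-straightened re-cleaned equation read in frame `(a ; b, c)` have the same lex-min vertex, the latter reading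
being non-empty.  No layer hypothesis. [new] -/
theorem vertexOf_polyPts_two_frames' (hab : a ≠ b) (hac : a ≠ c) (hbc : b ≠ c) {s : ℕ} {r : Fin 3 →₀ ℕ}
    (hrb : r b = 0) (hrc : r c = 0) {ν lam : K} (hνl : ν * lam = 1)
    (hLucas : ∀ D T : ℕ, q ∣ D → ¬ q ∣ T → ((D.choose T : ℕ) : K) = 0) (F : MvPolynomial (Fin 3) K)
    (hwall : ∀ D ∈ F.support, r a ≤ D a) (hdeg : ∀ D ∈ F.support, r a + s ≤ D.degree)
    (hne : (polyPts s r a b c (deletePthPowers q (shear c b lam F))).Nonempty) :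
    (polyPts s r a c b (deletePthPowers q (shear b c ν F))).Nonempty ∧
      vertexOf (polyPts s r a c b (deletePthPowers q (shear b c ν F))) =
        vertexOf (polyPts s r a b c (deletePthPowers q (shear c b lam F))) := by
  classical
  obtain ⟨h12, h21⟩ := shearDom_of_mul_eq_one hab hac.symm hbc.symm hνl hLucas s F
  refine vertexOf_polyPts_eq_of_lineDom' hab hac hbc hrb hrc (fun E hE hEb => h12 E hE hEb) (fun E' hE' hE'c => h21 E' hE' hE'c)
    (fun E' hE' => ?_) (fun E' hE' => ?_) hne
  · obtain ⟨D, hD, hDa, -, -⟩ := exists_dom_of_mem_support_shear hab.symm hbc hac hLucas lam F hE'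
    rw [support_deletePthPowers', Finset.mem_filter] at hD
    rw [← hDa]; exact hwall D hD.1
  · obtain ⟨D, hD, -, hDdeg, -⟩ := exists_dom_of_mem_support_shear hab.symm hbc hac hLucas lam F hE'
    rw [support_deletePthPowers', Finset.mem_filter] at hD
    rw [← hDdeg]; exact hdeg D hD.1

/-- Corollary: same `ŷ` and `x̂` in the two frames (axis allowed). [new] -/
theorem betaOf_polyPts_two_frames' (hab : a ≠ b) (hac : a ≠ c) (hbc : b ≠ c) {s : ℕ} {r : Fin 3 →₀ ℕ}
    (hrb : r b = 0) (hrc : r c = 0) {ν lam : K} (hνl : ν * lam = 1)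
    (hLucas : ∀ D T : ℕ, q ∣ D → ¬ q ∣ T → ((D.choose T : ℕ) : K) = 0) (F : MvPolynomial (Fin 3) K)
    (hwall : ∀ D ∈ F.support, r a ≤ D a) (hdeg : ∀ D ∈ F.support, r a + s ≤ D.degree)
    (hne : (polyPts s r a b c (deletePthPowers q (shear c b lam F))).Nonempty) :
    betaOf (polyPts s r a c b (deletePthPowers q (shear b c ν F))) = betaOf (polyPts s r a b c (deletePthPowers q (shear c b lam F))) ∧
      alphaOf (polyPts s r a c b (deletePthPowers q (shear b c ν F))) =
        alphaOf (polyPts s r a b c (deletePthPowers q (shear c b lam F))) := by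
  have h := (vertexOf_polyPts_two_frames' hab hac hbc hrb hrc hνl hLucas F hwall hdeg hne).2
  unfold betaOf alphaOf
  rw [h]
  exact ⟨rfl, rfl⟩

end FrameDomDegree

section TwoFramesWalk

variable [DecidableEq K] {s₀ : State (Fin 3) K}

/-- **FRAME INDEPENDENCE AT A WALK WALL STATE (PROVED; NODE-g29 §3ter (S3′)).**  At a one-wall state `v` (`r_v = M e_a`, degrees `≥ M + s`,
`q ≤ s + M`) and for `ν·λ = 1`: the readings `(a ; c, b)` after `σ_{b,c,ν}` and `(a ; b, c)` after `σ_{c,b,λ}` of `F_v` have the same `ŷ` (and `x̂`).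
All hypotheses are walk facts. [new] -/
theorem betaOf_polyPts_two_frames_walk (hs : IsRoot q s₀) (W : ForcedWalk q s₀) (v : ℕ) {a b c : Fin 3}
    (hab : a ≠ b) (hac : a ≠ c) (hbc : b ≠ c) (hLucas : ∀ D T : ℕ, q ∣ D → ¬ q ∣ T → ((D.choose T : ℕ) : K) = 0)
    {ν lam : K} (hνl : ν * lam = 1) {s M : ℕ} (hord : ∀ D ∈ (W.st v).F.support, M + s ≤ D.degree)
    (hrva : (W.st v).r a = M) (hrvb : (W.st v).r b = 0) (hrvc : (W.st v).r c = 0) (hq : q ≤ s + (W.st v).r a) :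
    betaOf (polyPts s (W.st v).r a c b (deletePthPowers q (shear b c ν (W.st v).F))) =
        betaOf (polyPts s (W.st v).r a b c (deletePthPowers q (shear c b lam (W.st v).F))) ∧
      alphaOf (polyPts s (W.st v).r a c b (deletePthPowers q (shear b c ν (W.st v).F))) =
        alphaOf (polyPts s (W.st v).r a b c (deletePthPowers q (shear c b lam (W.st v).F))) :=
  betaOf_polyPts_two_frames' hab hac hbc hrvb hrvc hνl hLucas (W.st v).F (fun D hD => walk_r hs W v D hD a)
    (fun D hD => by rw [hrva]; exact hord D hD) (polyPts_straightened_nonempty hs W v hab hac hbc lam hLucas hq hrvc)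

end TwoFramesWalk

end Summit.ResolutionOfSingularities.ResolutionOfSingularities.Theorems.LossPolygon
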